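import Mathlib
import Summits.Ventures.AbcSig.Recipes.BS04
import Literature.NumberTheory.DiophantineGeometry.GeneralizedFermatSignatureNN2

/-!
# Venture AbcSig — `x⁷ + y⁷ = 29 z²` by 2-cover DESCENT (module «DESC7», engine-2 g18): a conditional theorem with an
elementary, kernel-checked descent and three NAMED hypotheses

HONEST FRAMING. A row-shaped CONDITIONAL theorem of a computation cell (`pub-abcsig`); no claim on ABC or any summit. What is
PROVED here (kernel): (i) the descent `descent29m` — a solution of `x⁷ + y⁷ = 29·m·z²` (`x, y` coprime, `z ≠ 0`, `7 ∤ m`,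
`m` coprime to `H(x, y) = (x⁷ + y⁷)/(x + y)`) gives `H(x, y) = δ w²` with `δ ∈ {1, 7, 29, 203}`, i.e. a rational point on the
genus-2 curve `δ Y² = Φ₁₄(t)` (`Φ₁₄(t) = t⁶ − t⁵ + t⁴ − t³ + t² − t + 1`, `t = x/y`); (ii) the two explicit degree-2 maps to the
elliptic quotients, `(t, Y) ↦ (29t/(t−1)², 29²Y/(t−1)³)` onto `E⁻₂₉ : V² = U³ + 174 U² + 4205 U + 24389` (`δ = 29`) and
`(t, Y) ↦ (−7·203·t/(t+1)², 7·203²·Y/(t+1)³)` onto `E⁺₂₀₃ : V² = U³ + 2842 U² + 2019241 U + 409905923` (`δ = 203`); (iii) the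
assembly for `C = 29` and `C = 58` (and any `C = 29·m` whose `m` is supplied with the coprimality fact, cf.
`H7_coprime_two_three_five`). What is ASSUMED — the trusted base is EXACTLY three named hypotheses, all kept as binders (nothing here asserts them; no axiom):
(H1, CITED Literature Prop) `Literature.NumberTheory.DiophantineGeometry.ivorra2007_cyclotomicCurves` — Ivorra 2007
(Dissertationes Math. 444), BOTH clauses at `p = 7`: `C₇(ℚ) = {(−1, ±1), (0, ±1)}` (used for `δ = 1`) and `D₇ : 7y² = Φ₇(x) ⇒ x = 1`
(used for `δ = 7`; the module's own rank-0 witness `E⁺₇`, conductor 784, reproduces this case instrument-side = [Kraus 2002]);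
(H2, COMPUTED) `hE29` — «`E⁻₂₉ : V² = U³ + 174 U² + 4205 U + 24389` has no affine rational point» (coefficients `6δ, 5δ², δ³` at
`δ = 29`); (H3, COMPUTED) `hE203` — «`E⁺₂₀₃ : V² = U³ + 2842 U² + 2019241 U + 409905923` has no affine rational point» (`14δ, 49δ²,
49δ³` at `δ = 203`). H2/H3 are engine-2 g18 DESC7 §3 certificates (`RECORD-DESC7-engine2-g18.md`; certs `DESC7_C29.engine2.json`
8aa911bd7420c83f, `DESC7_C203.engine2.json` b92270d1a8eac756): `L(E, 1) ≠ 0` certified numerically with explicit error bounds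
(7.4843086505 resp. 3.9990647658) ⇒ rank 0 by [Kolyvagin / Gross–Zagier, Silverman AEC C.16.5.5] on modularity [BCDT 2001, AEC
C.13.6], torsion trivial by `E(ℚ)_tors ↪ Ẽ(𝔽_p)` (`#Ẽ⁻₂₉(𝔽₃) = 1`; `gcd(#Ẽ⁺₂₀₃(𝔽₃), #Ẽ⁺₂₀₃(𝔽₅)) = gcd(3, 5) = 1`); cross-read by
PARI/GP (kit j235164: ellrank 2-descent upper bound 0 on both, L(E,1) equal to ≥ 10 digits; labelled third instrument). Module DESC7
is STAGED-1 at filing (lead RULING DESC7-1, 2026-08-25T06:41Z; adoption waits for p1's second implementation); this file is its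
kernel-checked descent skeleton, NOT a row of record; no CLAIMS-LEDGER entry derives from it.
engine-2 g18 (prover-pub-abcsig-eng-2-g18-0), 2026-08-25.
-/

namespace Summit.Ventures.AbcSig.Desc7

open Polynomial

/-- `H(a, b) = (a⁷ + b⁷)/(a + b)`. -/
def H7 (a b : ℤ) : ℤ := a ^ 6 - a ^ 5 * b + a ^ 4 * b ^ 2 - a ^ 3 * b ^ 3 + a ^ 2 * b ^ 4 - a * b ^ 5 + b ^ 6

/-- The quotient `Q` in `H(a, b) = (a + b)·Q(a, b) + 7 b⁶` (Taylor expansion at `a = −b`). -/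
def Q7 (a b : ℤ) : ℤ :=
  -21 * b ^ 5 + 35 * b ^ 4 * (a + b) - 35 * b ^ 3 * (a + b) ^ 2 + 21 * b ^ 2 * (a + b) ^ 3 - 7 * b * (a + b) ^ 4
    + (a + b) ^ 5

/-- `(a + b)·H(a, b) = a⁷ + b⁷`. -/
theorem H7_mul (a b : ℤ) : (a + b) * H7 a b = a ^ 7 + b ^ 7 := by unfold H7; ring

/-- Taylor form `H(a, b) = 7 b⁶ + (a + b)·Q(a, b)`. -/
theorem H7_taylor (a b : ℤ) : H7 a b = 7 * b ^ 6 + (a + b) * Q7 a b := by unfold H7 Q7; ring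

/-- `H(a, b) > 0` as soon as `a + b ≠ 0` (it has the sign of `(a⁷ + b⁷)/(a + b)`). -/
theorem H7_pos (a b : ℤ) (hab : a + b ≠ 0) : 0 < H7 a b := by
  have key := H7_mul a b
  have hmono : StrictMono fun x : ℤ => x ^ 7 := Odd.strictMono_pow (by decide)
  rcases lt_or_gt_of_ne hab with h | h
  · have h1 : a < -b := by linarith
    have h2 : a ^ 7 < (-b) ^ 7 := hmono h1
    have h3 : a ^ 7 + b ^ 7 < 0 := by
      have : (-b) ^ 7 = -b ^ 7 := by ring
      linarith
    by_contra hH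
    push Not at hH
    nlinarith [mul_nonneg (neg_nonneg.mpr h.le) (neg_nonneg.mpr hH)]
  · have h1 : -b < a := by linarith
    have h2 : (-b) ^ 7 < a ^ 7 := hmono h1
    have h3 : 0 < a ^ 7 + b ^ 7 := by
      have : (-b) ^ 7 = -b ^ 7 := by ring
      linarith
    by_contra hH
    push Not at hH
    nlinarith [mul_nonneg h.le (neg_nonneg.mpr hH)]

/-- `7` is prime in `ℤ`. -/
private theorem prime_seven : Prime (7 : ℤ) := Int.prime_iff_natAbs_prime.mpr (by norm_num)
/-- `29` is prime in `ℤ`. -/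
private theorem prime_twentynine : Prime (29 : ℤ) := Int.prime_iff_natAbs_prime.mpr (by norm_num)

/-- From `P · R = c²` with `P, R` coprime and `P > 0`: `P` is a square. -/
private theorem sq_of_coprime_pos {P R c : ℤ} (hcop : IsCoprime P R) (heq : P * R = c ^ 2) (hpos : 0 < P) :
    ∃ w : ℤ, P = w ^ 2 := by
  obtain ⟨w, hw | hw⟩ := Int.sq_of_isCoprime hcop heq
  · exact ⟨w, hw⟩
  · exfalso; nlinarith [sq_nonneg w]

/-- **Descent lemma** (RECORD-DESC7 §1 at `C = 29·m`, `7 ∤ m`, `m` coprime to `H(x, y)`): a solution of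
`x⁷ + y⁷ = 29 m z²` with `x, y` coprime and `z ≠ 0` gives `H(x, y) = δ w²` with `δ ∈ {1, 7, 29, 203}`. -/
theorem descent29m (m a b c : ℤ) (h7m : ¬ (7 : ℤ) ∣ m) (hmH : IsCoprime m (H7 a b))
    (heq : a ^ 7 + b ^ 7 = 29 * m * c ^ 2) (hab : IsCoprime a b) (hc0 : c ≠ 0) :
    ∃ δ : ℤ, (δ = 1 ∨ δ = 7 ∨ δ = 29 ∨ δ = 203) ∧ ∃ w : ℤ, H7 a b = δ * w ^ 2 := by
  have hm0 : m ≠ 0 := by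
    rintro rfl; exact h7m (dvd_zero 7)
  have hprod : (a + b) * H7 a b = 29 * m * c ^ 2 := by rw [H7_mul, heq]
  have hsum : a + b ≠ 0 := by
    intro h0
    have h1 : (29 : ℤ) * m * c ^ 2 = 0 := by rw [← hprod, h0, zero_mul]
    have h2 : c ^ 2 ≠ 0 := pow_ne_zero 2 hc0
    have h3 : (29 : ℤ) * m ≠ 0 := mul_ne_zero (by norm_num) hm0
    exact (mul_ne_zero h3 h2) h1
  have hHpos : 0 < H7 a b := H7_pos a b hsum
  -- `a + b` is coprime to `b`, hence to `b⁶`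
  have hcop_b : IsCoprime (a + b) b := by
    have := hab.symm.add_mul_left_right 1
    simpa [mul_one] using this.symm
  have hcop_b6 : IsCoprime (a + b) (b ^ 6) := hcop_b.pow_right
  have hmH' : IsCoprime (H7 a b) m := hmH.symm
  by_cases h7 : (7 : ℤ) ∣ a + b
  · -- Case 7 ∣ a + b :  H = 7 · H'' with 7 ∤ H''
    obtain ⟨u, hu⟩ := h7
    set H'' : ℤ := u * Q7 a b + b ^ 6 with hH''def
    have hHfac : H7 a b = 7 * H'' := by rw [H7_taylor, hu, hH''def]; ring
    have h7b : ¬ (7 : ℤ) ∣ b := by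
      have h1 : IsCoprime (7 * u) b := by rw [← hu]; exact hcop_b
      exact (Prime.coprime_iff_not_dvd prime_seven).mp h1.of_mul_left_left
    have hQ : Q7 a b = 7 * (-3 * b ^ 5 + 5 * b ^ 4 * (a + b) - 5 * b ^ 3 * (a + b) ^ 2 + 3 * b ^ 2 * (a + b) ^ 3
        - b * (a + b) ^ 4 + 7 ^ 4 * u ^ 5) := by
      have ha' : a = 7 * u - b := by linarith
      unfold Q7; rw [ha']; ring
    have h7H'' : ¬ (7 : ℤ) ∣ H'' := by
      intro hd
      have hQ7 : (7 : ℤ) ∣ Q7 a b := ⟨_, hQ⟩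
      have : (7 : ℤ) ∣ b ^ 6 := by
        have e : b ^ 6 = H'' - u * Q7 a b := by rw [hH''def]; ring
        rw [e]
        exact dvd_sub hd (dvd_mul_of_dvd_right hQ7 u)
      exact h7b (prime_seven.dvd_of_dvd_pow this)
    have hH''pos : 0 < H'' := by
      have : 0 < 7 * H'' := by rw [← hHfac]; exact hHpos
      linarith
    have hH''m : IsCoprime H'' m := by
      have : IsCoprime (7 * H'') m := by rw [← hHfac]; exact hmH'
      exact this.of_mul_left_right
    -- 49 u H'' = 29 m c², so 7 ∣ c
    have h49 : 49 * (u * H'') = 29 * m * c ^ 2 := by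
      have := hprod; rw [hu, hHfac] at this; linarith
    have h7c : (7 : ℤ) ∣ c := by
      have h1 : (7 : ℤ) ∣ 29 * m * c ^ 2 := ⟨7 * (u * H''), by linarith⟩
      rcases prime_seven.dvd_or_dvd h1 with h2 | h2
      · rcases prime_seven.dvd_or_dvd h2 with h3 | h3
        · exfalso; revert h3; decide
        · exact absurd h3 h7m
      · exact prime_seven.dvd_of_dvd_pow h2
    obtain ⟨c', hc'⟩ := h7c
    have hprod' : u * H'' = 29 * m * c' ^ 2 := by
      rw [hc'] at h49; nlinarith
    -- u and H'' are coprime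
    have hcop_u : IsCoprime u H'' := by
      have h1 : IsCoprime (7 * u) (b ^ 6) := by rw [← hu]; exact hcop_b6
      have h2 : IsCoprime u (b ^ 6) := h1.of_mul_left_right
      have h3 := h2.add_mul_left_right (Q7 a b)
      have e : b ^ 6 + u * Q7 a b = H'' := by rw [hH''def]; ring
      rwa [e] at h3
    by_cases h29 : (29 : ℤ) ∣ H''
    · -- δ = 203
      obtain ⟨K, hK⟩ := h29
      have hKpos : 0 < K := by nlinarith
      have hcopK : IsCoprime K (m * u) := by
        have h1 : IsCoprime u (29 * K) := by rw [← hK]; exact hcop_u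
        have h2 : IsCoprime (29 * K) m := by rw [← hK]; exact hH''m
        exact (h2.of_mul_left_right).mul_right h1.of_mul_right_right.symm
      have heqK : K * (m * u) = (m * c') ^ 2 := by
        have h1 : u * (29 * K) = 29 * m * c' ^ 2 := by rw [← hK]; exact hprod'
        have h2 : u * K = m * c' ^ 2 := by
          have h3 : (29 : ℤ) * (u * K) = 29 * (m * c' ^ 2) := by linear_combination h1
          exact mul_left_cancel₀ (by norm_num : (29 : ℤ) ≠ 0) h3
        linear_combination m * h2
      obtain ⟨w, hw⟩ := sq_of_coprime_pos hcopK heqK hKpos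
      refine ⟨203, by norm_num, w, ?_⟩
      rw [hHfac, hK, hw]; ring
    · -- δ = 7
      have hcop29 : IsCoprime (29 : ℤ) H'' := (Prime.coprime_iff_not_dvd prime_twentynine).mpr h29
      have hcopAll : IsCoprime H'' (29 * m * u) := (hcop29.symm.mul_right hH''m).mul_right hcop_u.symm
      have heq2 : H'' * (29 * m * u) = (29 * m * c') ^ 2 := by linear_combination (29 * m) * hprod'
      obtain ⟨w, hw⟩ := sq_of_coprime_pos hcopAll heq2 hH''pos
      refine ⟨7, by norm_num, w, ?_⟩
      rw [hHfac, hw]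
  · -- Case 7 ∤ a + b :  (a + b) and H coprime
    have hcop7 : IsCoprime (a + b) 7 := ((Prime.coprime_iff_not_dvd prime_seven).mpr h7).symm
    have hcopH : IsCoprime (a + b) (H7 a b) := by
      have h1 : IsCoprime (a + b) (7 * b ^ 6) := hcop7.mul_right hcop_b6
      have h2 := h1.add_mul_left_right (Q7 a b)
      rwa [← H7_taylor] at h2
    by_cases h29 : (29 : ℤ) ∣ H7 a b
    · -- δ = 29
      obtain ⟨K, hK⟩ := h29
      have hKpos : 0 < K := by nlinarith
      have hcopK : IsCoprime K (m * (a + b)) := by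
        have h1 : IsCoprime (a + b) (29 * K) := by rw [← hK]; exact hcopH
        have h2 : IsCoprime (29 * K) m := by rw [← hK]; exact hmH'
        exact (h2.of_mul_left_right).mul_right h1.of_mul_right_right.symm
      have heqK : K * (m * (a + b)) = (m * c) ^ 2 := by
        have h1 : (a + b) * (29 * K) = 29 * m * c ^ 2 := by rw [← hK]; exact hprod
        have h2 : (a + b) * K = m * c ^ 2 := by
          have h3 : (29 : ℤ) * ((a + b) * K) = 29 * (m * c ^ 2) := by linear_combination h1
          exact mul_left_cancel₀ (by norm_num : (29 : ℤ) ≠ 0) h3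
        linear_combination m * h2
      obtain ⟨w, hw⟩ := sq_of_coprime_pos hcopK heqK hKpos
      exact ⟨29, by norm_num, w, by rw [hK, hw]⟩
    · -- δ = 1
      have hcop29 : IsCoprime (29 : ℤ) (H7 a b) := (Prime.coprime_iff_not_dvd prime_twentynine).mpr h29
      have hcopAll : IsCoprime (H7 a b) (29 * m * (a + b)) :=
        (hcop29.symm.mul_right hmH').mul_right hcopH.symm
      have heq2 : H7 a b * (29 * m * (a + b)) = (29 * m * c) ^ 2 := by linear_combination (29 * m) * hprod
      obtain ⟨w, hw⟩ := sq_of_coprime_pos hcopAll heq2 hHpos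
      exact ⟨1, by norm_num, w, by rw [hw]; ring⟩

/-- `Φ₇(−t) = Φ₁₄(t)`: the value of Mathlib's 7th cyclotomic polynomial at `−t`. -/
theorem cyclotomic7_eval_neg (t : ℚ) :
    (Polynomial.cyclotomic 7 ℚ).eval (-t) = t ^ 6 - t ^ 5 + t ^ 4 - t ^ 3 + t ^ 2 - t + 1 := by
  haveI := Fact.mk (by norm_num : Nat.Prime 7)
  rw [Polynomial.cyclotomic_prime, Polynomial.eval_finsetSum]
  simp only [Polynomial.eval_pow, Polynomial.eval_X, Finset.sum_range_succ, Finset.sum_range_zero]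
  ring

/-- **DESC7 for `C = 29·m`** (RECORD-DESC7-engine2-g18; `m ≥ 1`, `7 ∤ m`, no prime of `m` divides a value `H(x, y)` at
coprime `x, y` — supplied per `m` below): `x⁷ + y⁷ = 29 m z²` has no primitive solution — both parity classes at once — GIVEN
Ivorra's determination of `C₇(ℚ)`, `D₇(ℚ)` (CITED) and the absence of affine rational points on the two rank-0 elliptic
quotients `E⁻₂₉`, `E⁺₂₀₃` (COMPUTED: `L(E,1) ≠ 0` + Kolyvagin + trivial torsion). -/
theorem x7y7_eq_29m_zsq_desc7 (m : ℕ) (hm : 1 ≤ m) (h7m : ¬ (7 : ℤ) ∣ (m : ℤ))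
    (hmH : ∀ a b : ℤ, IsCoprime a b → IsCoprime (m : ℤ) (H7 a b))
    (hI : Literature.NumberTheory.DiophantineGeometry.ivorra2007_cyclotomicCurves)
    (hE29 : ∀ U V : ℚ, V ^ 2 ≠ U ^ 3 + 174 * U ^ 2 + 4205 * U + 24389)
    (hE203 : ∀ U V : ℚ, V ^ 2 ≠ U ^ 3 + 2842 * U ^ 2 + 2019241 * U + 409905923)
    (a b c : ℤ) : ¬ IsPrimitiveSolution 1 1 (29 * m) 7 a b c := by
  intro hsol
  obtain ⟨heq, ha, hb, hc, hab, hac, hbc⟩ := hsol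
  simp only [Nat.cast_one, one_mul, Nat.cast_mul, Nat.cast_ofNat] at heq ha hb hc hab hac hbc
  have hm0 : (m : ℤ) ≠ 0 := by exact_mod_cast (by omega : m ≠ 0)
  have hc0 : c ≠ 0 := by intro h0; apply hc; rw [h0]; ring
  obtain ⟨δ, hδ, w, hw⟩ := descent29m m a b c h7m (hmH a b hab) (by rw [heq]) hab hc0
  -- a ≠ b and a ≠ -b
  have hne1 : a ≠ b := by
    intro h1
    have hu : IsUnit a := by
      have : IsCoprime a a := by simpa [h1] using hab
      exact (isCoprime_self).mp this
    have hc2 : 0 < c ^ 2 := sq_pos_iff.mpr hc0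
    have hm1 : (1 : ℤ) ≤ m := by exact_mod_cast hm
    rcases Int.isUnit_iff.mp hu with h2 | h2
    · have h3 : (29 : ℤ) * m * c ^ 2 = 2 := by rw [← heq, ← h1, h2]; norm_num
      nlinarith
    · have h3 : (29 : ℤ) * m * c ^ 2 = -2 := by rw [← heq, ← h1, h2]; norm_num
      nlinarith
  have hne2 : a + b ≠ 0 := by
    intro h0
    have hb' : b = -a := by linarith
    have h1 : (29 : ℤ) * m * c ^ 2 = 0 := by rw [← heq, hb']; ring
    have h2 : c ^ 2 ≠ 0 := pow_ne_zero 2 hc0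
    exact (mul_ne_zero (mul_ne_zero (by norm_num) hm0) h2) h1
  -- the rational point (t, Y) on δ Y² = Φ₁₄(t)
  set t : ℚ := (a : ℚ) / b with ht
  set Y : ℚ := (w : ℚ) / (b : ℚ) ^ 3 with hY
  have hbq : (b : ℚ) ≠ 0 := by exact_mod_cast hb
  have hwq : ((H7 a b : ℤ) : ℚ) = (δ : ℚ) * (w : ℚ) ^ 2 := by exact_mod_cast hw
  have hHq : ((H7 a b : ℤ) : ℚ) = (a : ℚ) ^ 6 - (a : ℚ) ^ 5 * b + (a : ℚ) ^ 4 * (b : ℚ) ^ 2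
      - (a : ℚ) ^ 3 * (b : ℚ) ^ 3 + (a : ℚ) ^ 2 * (b : ℚ) ^ 4 - a * (b : ℚ) ^ 5 + (b : ℚ) ^ 6 := by
    unfold H7; push_cast; ring
  have hcurve : (δ : ℚ) * Y ^ 2 = t ^ 6 - t ^ 5 + t ^ 4 - t ^ 3 + t ^ 2 - t + 1 := by
    rw [ht, hY]
    field_simp
    linear_combination (-1 : ℚ) * hwq + hHq
  have ht1 : t ≠ 1 := by
    intro h1; apply hne1
    have : (a : ℚ) = b := by rw [ht] at h1; field_simp at h1; linarith
    exact_mod_cast this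
  have htm1 : t ≠ -1 := by
    intro h1; apply hne2
    have : (a : ℚ) = -b := by rw [ht] at h1; field_simp at h1; linarith
    exact_mod_cast (by push_cast; linarith : ((a + b : ℤ) : ℚ) = 0)
  have ht0 : t ≠ 0 := by
    intro h0; apply ha
    have : (a : ℚ) = 0 := by rw [ht] at h0; field_simp at h0; simpa using h0
    exact_mod_cast this
  have h7mem : (7 : ℕ) ∈ ({7, 11, 13, 17} : Finset ℕ) := by decide
  rcases hδ with rfl | rfl | rfl | rfl
  · -- δ = 1 : (−t, Y) ∈ C₇(ℚ) ⇒ −t ∈ {−1, 0}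
    have hC := (hI 7 h7mem (-t) Y).1
    have hpt : Y ^ 2 = (Polynomial.cyclotomic 7 ℚ).eval (-t) := by
      rw [cyclotomic7_eval_neg]; push_cast at hcurve; linarith
    rcases (hC hpt).1 with h1 | h1
    · exact ht1 (by linarith)
    · exact ht0 (by linarith)
  · -- δ = 7 : (−t, Y) ∈ D₇(ℚ) ⇒ −t = 1
    have hD := (hI 7 h7mem (-t) Y).2
    have hpt : ((7 : ℕ) : ℚ) * Y ^ 2 = (Polynomial.cyclotomic 7 ℚ).eval (-t) := by
      rw [cyclotomic7_eval_neg]; push_cast at hcurve ⊢; linarith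
    exact htm1 (by linarith [(hD hpt).1])
  · -- δ = 29 : the quotient map φ⁻ lands on E⁻₂₉
    have hd : t - 1 ≠ 0 := sub_ne_zero.mpr ht1
    apply hE29 (29 * t / (t - 1) ^ 2) (29 ^ 2 * Y / (t - 1) ^ 3)
    have key : (29 ^ 2 * Y / (t - 1) ^ 3) ^ 2
        - ((29 * t / (t - 1) ^ 2) ^ 3 + 174 * (29 * t / (t - 1) ^ 2) ^ 2 + 4205 * (29 * t / (t - 1) ^ 2) + 24389)
        = 29 ^ 3 * ((29 : ℚ) * Y ^ 2 - (t ^ 6 - t ^ 5 + t ^ 4 - t ^ 3 + t ^ 2 - t + 1)) / (t - 1) ^ 6 := by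
      field_simp
      ring
    have hz : (29 : ℚ) * Y ^ 2 - (t ^ 6 - t ^ 5 + t ^ 4 - t ^ 3 + t ^ 2 - t + 1) = 0 := by
      push_cast at hcurve; linarith
    rw [hz, mul_zero, zero_div] at key
    linarith
  · -- δ = 203 : the quotient map φ⁺ lands on E⁺₂₀₃
    have hd : t + 1 ≠ 0 := by
      intro h0; exact htm1 (by linarith)
    apply hE203 (-7 * 203 * t / (t + 1) ^ 2) (7 * 203 ^ 2 * Y / (t + 1) ^ 3)
    have key : (7 * 203 ^ 2 * Y / (t + 1) ^ 3) ^ 2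
        - ((-7 * 203 * t / (t + 1) ^ 2) ^ 3 + 2842 * (-7 * 203 * t / (t + 1) ^ 2) ^ 2
            + 2019241 * (-7 * 203 * t / (t + 1) ^ 2) + 409905923)
        = 49 * 203 ^ 3 * ((203 : ℚ) * Y ^ 2 - (t ^ 6 - t ^ 5 + t ^ 4 - t ^ 3 + t ^ 2 - t + 1)) / (t + 1) ^ 6 := by
      field_simp
      ring
    have hz : (203 : ℚ) * Y ^ 2 - (t ^ 6 - t ^ 5 + t ^ 4 - t ^ 3 + t ^ 2 - t + 1) = 0 := by
      push_cast at hcurve; linarith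
    rw [hz, mul_zero, zero_div] at key
    linarith

/-- `H(a, b)` is coprime to 2, 3 and 5 when `a, b` are coprime (`Φ₇` has no root in `𝔽₂, 𝔽₃, 𝔽₅`). -/
theorem H7_coprime_two_three_five (a b : ℤ) (hab : IsCoprime a b) (q : ℕ) (hq : q = 2 ∨ q = 3 ∨ q = 5) :
    IsCoprime (q : ℤ) (H7 a b) := by
  have key : ∀ x y : ZMod q, x ^ 6 - x ^ 5 * y + x ^ 4 * y ^ 2 - x ^ 3 * y ^ 3 + x ^ 2 * y ^ 4 - x * y ^ 5 + y ^ 6 = 0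
      → x = 0 ∧ y = 0 := by
    rcases hq with rfl | rfl | rfl <;> decide
  have hqp : Nat.Prime q := by rcases hq with rfl | rfl | rfl <;> norm_num
  haveI : NeZero q := ⟨hqp.ne_zero⟩
  have hqp' : Prime (q : ℤ) := Int.prime_iff_natAbs_prime.mpr (by simpa using hqp)
  rw [Prime.coprime_iff_not_dvd hqp']
  intro hdvd
  -- reduce modulo q: H(a, b) ≡ 0 forces a ≡ b ≡ 0
  have hz : ((H7 a b : ℤ) : ZMod q) = 0 := by
    rw [ZMod.intCast_zmod_eq_zero_iff_dvd]; exact_mod_cast hdvd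
  have hab' : ((a : ℤ) : ZMod q) = 0 ∧ ((b : ℤ) : ZMod q) = 0 := by
    apply key; unfold H7 at hz; push_cast at hz; exact hz
  rw [ZMod.intCast_zmod_eq_zero_iff_dvd, ZMod.intCast_zmod_eq_zero_iff_dvd] at hab'
  obtain ⟨h1, h2⟩ := hab'
  have hu : IsUnit (q : ℤ) := hab.isUnit_of_dvd' h1 h2
  rcases Int.isUnit_iff.mp hu with h | h
  · have : q = 1 := by exact_mod_cast h
    exact hqp.one_lt.ne' this
  · have : (0 : ℤ) ≤ q := by positivity
    linarith

/-- **`x⁷ + y⁷ = 29 z²`** has no primitive solution (the cell's `C = 29` at `n = 7`, both parity classes), GIVEN the named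
hypotheses of `x7y7_eq_29m_zsq_desc7`. -/
theorem x7y7_eq_29zsq_desc7
    (hI : Literature.NumberTheory.DiophantineGeometry.ivorra2007_cyclotomicCurves)
    (hE29 : ∀ U V : ℚ, V ^ 2 ≠ U ^ 3 + 174 * U ^ 2 + 4205 * U + 24389)
    (hE203 : ∀ U V : ℚ, V ^ 2 ≠ U ^ 3 + 2842 * U ^ 2 + 2019241 * U + 409905923)
    (a b c : ℤ) : ¬ IsPrimitiveSolution 1 1 29 7 a b c := by
  have h := x7y7_eq_29m_zsq_desc7 1 le_rfl (by decide) (fun a b _ => isCoprime_one_left) hI hE29 hE203 a b c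
  simpa using h

/-- **`x⁷ + y⁷ = 58 z²`** has no primitive solution (`C = 58 = 2·29`; the census holds no level for it), GIVEN the same
hypotheses. -/
theorem x7y7_eq_58zsq_desc7
    (hI : Literature.NumberTheory.DiophantineGeometry.ivorra2007_cyclotomicCurves)
    (hE29 : ∀ U V : ℚ, V ^ 2 ≠ U ^ 3 + 174 * U ^ 2 + 4205 * U + 24389)
    (hE203 : ∀ U V : ℚ, V ^ 2 ≠ U ^ 3 + 2842 * U ^ 2 + 2019241 * U + 409905923)
    (a b c : ℤ) : ¬ IsPrimitiveSolution 1 1 58 7 a b c := by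
  have h := x7y7_eq_29m_zsq_desc7 2 (by norm_num) (by decide)
    (fun a b hab => H7_coprime_two_three_five a b hab 2 (Or.inl rfl)) hI hE29 hE203 a b c
  simpa using h

end Summit.Ventures.AbcSig.Desc7
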